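import Summits.CriticalPhenomena.PercolationContinuityZ3.Theorems.PercNearOneGluingNoHeavyLowerTailAntitheticHandleDual
import Summits.CriticalPhenomena.PercolationContinuityZ3.Theorems.PercNearOneGluingNoHeavyLowerTailAntitheticComparable
import HarnessLib

/-!
# `NoHeavyLowerTail` (stmt-CriticalPhenomena-4575) — antithetic cluster pairs: **THEOREM KnH⁻ — a CLIQUE WITH AN ARBITRARILY ATTACHED
# SOURCE PLUS A HANDLE** (CONJECTURE Δ2 / the vertex antithetic inequality at `R = {x}`; prim-hp-2 gen 64, HOME/MEMO-gen64.md §3bis)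

Support file (`--supports stmt-CriticalPhenomena-4575`, hull-port prover `prim-hp-2`, gen 64).  No definitions, no named facts, no sorries;
standard axioms; no certificate.

THE GRAPH.  `E₀` a loop-free edge set whose pairs lie inside a vertex set `W`, with ALL pairs between vertices of `W` other than the source
`s` present (the vertices `≠ s` induce a clique; the pairs at `s` are arbitrary: `K_{m+1}` minus any set of pairs at `s`); a handle
`P = u 0 – … – u a = y – x – z = w b – … – w 0 = Q` with `Q ∈ W ∖ {s}` JOINED TO `s` (arms of fresh vertices, `x` fresh, `yz ∉ H`).
* `Antithetic.Clique.handle_vertex_sum_nonneg` — **THEOREM KnH⁻**: for all monotone `F, G`,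
  `0 ≤ Σ_{ω : ¬(x ∈ X_E ω ∧ x ∈ Y_E ω)} (F(X_E ω) − F(Y_E ω))·(G(X_E ω) − G(Y_E ω))`, `E = H + xy + xz`.
PROOF = DUAL HANDLE THEOREM with (⊕) = `Antithetic.Clique.oplus_nonneg` (comparability of the clusters, …AntitheticComparable) and
(M) = `Antithetic.Apex.mixed_nonneg` (`Q` is joined to `s` and to every other vertex of `W`).  …AntitheticCompleteHandle is the case of the
full clique.
[cite: VandenbergHaggstromKahn2005, §1 p. 6 ("Harris' inequality"), §1 p. 3 (open cluster `C_s`)]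
-/

noncomputable section

namespace Summit.CriticalPhenomena.PercolationContinuityZ3.Theorems

open Literature.Probability.Percolation
open scoped Classical

namespace Antithetic

namespace Clique

variable {V : Type*} [Fintype V] {W : Set V} {s P Q : V} {E₀ : Set (Sym2 V)}
  (hEW : ∀ e ∈ E₀, ∀ v ∈ e, v ∈ W) (hclique : ∀ u ∈ W, ∀ v ∈ W, u ≠ s → v ≠ s → u ≠ v → s(u, v) ∈ E₀)
  (hnd : ∀ f ∈ E₀, ¬ f.IsDiag) (hQW : Q ∈ W) (hQs : Q ≠ s) (hsQ : s(s, Q) ∈ E₀)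
  {u w : ℕ → V} {a b : ℕ} (hu0 : u 0 = P) (hw0 : w 0 = Q)
  (hufresh : ∀ i, 0 < i → i ≤ a → ∀ f ∈ E₀ ∪ Cyc.edgeSet b w, u i ∈ f → f.IsDiag)
  (hwfresh : ∀ i, 0 < i → i ≤ b → ∀ f ∈ E₀, w i ∈ f → f.IsDiag)
  (huinj : ∀ i j, i ≤ a → j ≤ a → u i = u j → i = j) (hwinj : ∀ i j, i ≤ b → j ≤ b → w i = w j → i = j)
  (hsu : ∀ i, 0 < i → i ≤ a → s ≠ u i) (hsw : ∀ i, 0 < i → i ≤ b → s ≠ w i)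
  (hPw : ∀ i, 0 < i → i ≤ b → P ≠ w i) (hzu : ∀ i, 0 < i → i ≤ a → w b ≠ u i)
include hEW hclique hnd hQW hQs hsQ hu0 hw0 hufresh hwfresh huinj hwinj hsu hsw hPw hzu

/-- **THEOREM KnH⁻ (clique with an attached source + handle, all arm lengths).**  With the notation of the module docstring, for all monotone
`F, G`: `0 ≤ Σ_{ω : ¬(x ∈ X_E ω ∧ x ∈ Y_E ω)} (F(X_E ω) − F(Y_E ω))·(G(X_E ω) − G(Y_E ω))` (`H` written `E₀ ∪ (stub ∪ arm)`). [this work] -/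
theorem handle_vertex_sum_nonneg {x : V}
    (hx : ∀ f ∈ E₀ ∪ (Cyc.edgeSet b w ∪ Cyc.edgeSet a u), x ∈ f → f.IsDiag)
    (hxs : x ≠ s) (hxy : x ≠ u a) (hxz : x ≠ w b) (hyz : u a ≠ w b) (hg : s(u a, w b) ∉ E₀ ∪ (Cyc.edgeSet b w ∪ Cyc.edgeSet a u))
    {F G : Set V → ℝ} (hF : Monotone F) (hG : Monotone G) :
    0 ≤ ∑ ω ∈ Finset.univ.filter (fun ω : Set (Sym2 V) =>
        ¬ ((openGraph (ω ∩ insert s(x, u a) (insert s(x, w b) (E₀ ∪ (Cyc.edgeSet b w ∪ Cyc.edgeSet a u))))).Reachable s x ∧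
          (openGraph (ωᶜ ∩ insert s(x, u a) (insert s(x, w b) (E₀ ∪ (Cyc.edgeSet b w ∪ Cyc.edgeSet a u))))).Reachable s x)),
      (F (openCluster (ω ∩ insert s(x, u a) (insert s(x, w b) (E₀ ∪ (Cyc.edgeSet b w ∪ Cyc.edgeSet a u)))) s) -
          F (openCluster (ωᶜ ∩ insert s(x, u a) (insert s(x, w b) (E₀ ∪ (Cyc.edgeSet b w ∪ Cyc.edgeSet a u)))) s)) *
        (G (openCluster (ω ∩ insert s(x, u a) (insert s(x, w b) (E₀ ∪ (Cyc.edgeSet b w ∪ Cyc.edgeSet a u)))) s) -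
          G (openCluster (ωᶜ ∩ insert s(x, u a) (insert s(x, w b) (E₀ ∪ (Cyc.edgeSet b w ∪ Cyc.edgeSet a u)))) s)) := by
  -- (edge set `E₀ ∪ (stub ∪ arm)`; the dual handle theorem writes `arm ∪ (E₀ ∪ stub)`)
  have hcomm : E₀ ∪ (Cyc.edgeSet b w ∪ Cyc.edgeSet a u) = Cyc.edgeSet a u ∪ (E₀ ∪ Cyc.edgeSet b w) := by
    rw [Set.union_comm (Cyc.edgeSet b w), Set.union_left_comm]
  rw [hcomm] at hx hg ⊢
  -- (⊕): comparability
  have hop := fun (K₁ K₂ : Set V → Set V → ℝ) hK₁ hso₁ hK₂ hso₂ => oplus_nonneg hEW hclique P K₁ K₂ hK₁ hso₁ hK₂ hso₂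
  -- (M): `Q` is an apex (joined to `s` by hypothesis and to the rest of `W` by the clique)
  have hapex : ∀ e ∈ E₀, ∀ v ∈ e, v ≠ Q → s(v, Q) ∈ E₀ := by
    intro e he v hv hvQ
    by_cases hvs : v = s
    · rw [hvs]; exact hsQ
    · exact hclique v (hEW e he v hv) Q hQW hvs hQs hvQ
  have hmix := fun (K₁ K₂ : Set V → Set V → ℝ) hK₁ hso₁ hK₂ hso₂ =>
    Apex.mixed_nonneg (E := E₀) (s := s) hapex P K₁ K₂ hK₁ hso₁ hK₂ hso₂
  have h := Pendant.handle_vertex_sum_nonneg_of_oplus hnd hwfresh hwinj hsw hPw hop hu0 hw0 hufresh huinj hsu hzu hmix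
    hx hxs hxy hxz hyz hg hF hG
  convert h using 3

end Clique

end Antithetic

end Summit.CriticalPhenomena.PercolationContinuityZ3.Theorems
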